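import Literature.MathematicalPhysics.StatisticalMechanics.Knauf1998.Graph
import Literature.MathematicalPhysics.StatisticalMechanics.Knauf1998.Kernel1
import Literature.MathematicalPhysics.StatisticalMechanics.Knauf1998.Kernel2
import Literature.MathematicalPhysics.StatisticalMechanics.Knauf1998.Kernel3
import Literature.MathematicalPhysics.StatisticalMechanics.Knauf1998.Kernel4
import Literature.MathematicalPhysics.StatisticalMechanics.Knauf1998.Kernel5
import HarnessLib

/-!
# Knauf (1998), Sect. 6 — `d = 15`: transport of `SL(2,ℤ/15ℤ)` and `G₁₅` to the kernel computation

Source: A. Knauf, *The number-theoretical spin chain and the Riemann zeroes*, Comm. Math. Phys. **196** (1998)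
703–731, doi:10.1007/s002200050441 [Knauf1998], Sect. 6 (Definitions 12, 13 and the Conjecture stated after them);
restated in A. Knauf, *Number theory, dynamical systems and statistical mechanics*, Rev. Math. Phys. **11** (1999)
1027–1060, §4.

`SL(2,ℤ/15ℤ)` elements correspond to the kernel's 4-tuples of residues (`nt`, `nt_injective`, `nt_mulP`, `nt_mulM`,
`isSL_nt`, `exists_nt_eq`); the fifteen kernel facts `Compute.checkA a = true` (`Kernel1..5`) assemble to
`checkAll_eq` and, per group element, `checkOne_nt`; unpacked (section `facts`) they give the `M₋`-invariance of `v`,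
the `M₊`-invariance of `sP`, the eigenvector identity `eigen_eq`, and the six non-incidences `vM_ne₁₋₃`, `vP_ne₁₋₃`
that make the three neighbours of each vertex distinct — whence `G15_regular : (G 15).IsRegularOfDegree 3`.

Provenance: refutations bundle `papers/_cross/refutations` (H21 seat pub-refute-2, 2026-08-18), package module
`Refutations.Knauf1998 (§ d = 15: transport)`, moved into the tree under the Lean-in-tree rule (human 2026-08-18); the eigenvector
table was GENERATED by that bundle's `tools/knauf_g15_gen.py` (pure Python, exact arithmetic; `--check` re-derives the
data file byte-for-byte) from the 2001 H21 study (archive `summits/rh/routes/knauf-spin-chain-ramanujan`).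

NOT here: the eigenvalue and the refutation (`Literature.MathematicalPhysics.StatisticalMechanics.Knauf1998.Eigenvalue`).
-/

namespace Literature.MathematicalPhysics.StatisticalMechanics.Knauf1998

open Compute (T4 K4)

/-! ## `d = 15`: transport to the kernel computation -/

/-- An element of `SL(2,ℤ/15ℤ)` as the kernel's 4-tuple of least residues. [folklore] -/
def nt (g : SL2 15) : T4 := (g.1.1.val, g.1.2.1.val, g.1.2.2.1.val, g.1.2.2.2.val)

/-- Auxiliary lemma: `: Function.Injective nt`. [folklore] -/
theorem nt_injective : Function.Injective nt := by
  rintro ⟨⟨a, b, c, e⟩, hg⟩ ⟨⟨a', b', c', e'⟩, hh⟩ h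
  simp only [nt, Prod.mk.injEq] at h
  obtain ⟨h₁, h₂, h₃, h₄⟩ := h
  apply Subtype.ext
  simp only [Prod.mk.injEq]
  exact ⟨ZMod.val_injective 15 h₁, ZMod.val_injective 15 h₂, ZMod.val_injective 15 h₃, ZMod.val_injective 15 h₄⟩

/-- Auxiliary lemma: `(a c : ZMod 15) : (-a - c).val = (30 - a.val - c.val) % 15`. [folklore] -/
private theorem val_neg_sub (a c : ZMod 15) : (-a - c).val = (30 - a.val - c.val) % 15 := by
  revert a c; decide +kernel

/-- Auxiliary lemma: `(a c : ZMod 15) : (-a + c).val = (15 + c.val - a.val) % 15`. [folklore] -/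
private theorem val_neg_add (a c : ZMod 15) : (-a + c).val = (15 + c.val - a.val) % 15 := by
  revert a c; decide +kernel

/-- Auxiliary lemma: `(a : ZMod 15) : (-a).val = (15 - a.val) % 15`. [folklore] -/
private theorem val_neg_eq (a : ZMod 15) : (-a).val = (15 - a.val) % 15 := by
  revert a; decide +kernel

/-- Auxiliary lemma: `(g : SL2 15) : nt (mulP g) = Compute.mulP (nt g)`. [folklore] -/
theorem nt_mulP (g : SL2 15) : nt (mulP g) = Compute.mulP (nt g) := by
  obtain ⟨⟨a, b, c, e⟩, h⟩ := g
  simp only [nt, mulP, Compute.mulP, val_neg_sub]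

/-- Auxiliary lemma: `(g : SL2 15) : nt (mulM g) = Compute.mulM (nt g)`. [folklore] -/
theorem nt_mulM (g : SL2 15) : nt (mulM g) = Compute.mulM (nt g) := by
  obtain ⟨⟨a, b, c, e⟩, h⟩ := g
  simp only [nt, mulM, Compute.mulM, val_neg_add, val_neg_eq]

/-- Auxiliary lemma: `(N : ℕ) : (N : ZMod 15) = 1 ↔ N % 15 = 1`. [folklore] -/
private theorem natCast_eq_one_iff (N : ℕ) : (N : ZMod 15) = 1 ↔ N % 15 = 1 := by
  have h := ZMod.natCast_eq_natCast_iff' N 1 15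
  rw [Nat.cast_one] at h
  rw [h]

/-- The determinant condition, in residues. [folklore] -/
theorem det_iff_isSL (a b c e : ZMod 15) :
    a * e - b * c = 1 ↔ (a.val * e.val + 225 - b.val * c.val) % 15 = 1 := by
  rw [← natCast_eq_one_iff]
  have hb := b.val_lt; have hc := c.val_lt
  have hle : b.val * c.val ≤ a.val * e.val + 225 := by nlinarith
  rw [Nat.cast_sub hle, Nat.cast_add, Nat.cast_mul, Nat.cast_mul, ZMod.natCast_zmod_val, ZMod.natCast_zmod_val,
    ZMod.natCast_zmod_val, ZMod.natCast_zmod_val, (ZMod.natCast_eq_zero_iff 225 15).2 (by norm_num), add_zero]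

/-- Auxiliary lemma: `(g : SL2 15) : Compute.isSL (nt g) = true`. [folklore] -/
theorem isSL_nt (g : SL2 15) : Compute.isSL (nt g) = true := by
  obtain ⟨⟨a, b, c, e⟩, h⟩ := g
  have h' := (det_iff_isSL a b c e).1 h
  simp only [Compute.isSL, nt, ZMod.val_lt, h', decide_true, Bool.and_self]

/-- Conversely every residue tuple accepted by `isSL` is an element of `SL(2,ℤ/15ℤ)` (so the kernel ranges over
exactly the group). [folklore] -/
theorem exists_nt_eq (t : T4) (ht : Compute.isSL t = true) : ∃ g : SL2 15, nt g = t := by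
  obtain ⟨A, B, C, E⟩ := t
  simp only [Compute.isSL, Bool.and_eq_true, decide_eq_true_eq] at ht
  obtain ⟨⟨⟨⟨hA, hB⟩, hC⟩, hE⟩, hdet⟩ := ht
  refine ⟨⟨((A : ZMod 15), (B : ZMod 15), (C : ZMod 15), (E : ZMod 15)), ?_⟩, ?_⟩
  · rw [det_iff_isSL]
    simpa [ZMod.val_natCast, Nat.mod_eq_of_lt hA, Nat.mod_eq_of_lt hB, Nat.mod_eq_of_lt hC,
      Nat.mod_eq_of_lt hE] using hdet
  · simp [nt, ZMod.val_natCast, Nat.mod_eq_of_lt hA, Nat.mod_eq_of_lt hB, Nat.mod_eq_of_lt hC,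
      Nat.mod_eq_of_lt hE]

/-- Auxiliary lemma: `: ∀ a, a < 15 → Compute.checkA a = true`. [folklore] -/
theorem checkA_all : ∀ a, a < 15 → Compute.checkA a = true := by
  intro a ha
  interval_cases a
  exacts [Compute.checkA_0, Compute.checkA_1, Compute.checkA_2, Compute.checkA_3, Compute.checkA_4,
    Compute.checkA_5, Compute.checkA_6, Compute.checkA_7, Compute.checkA_8, Compute.checkA_9, Compute.checkA_10,
    Compute.checkA_11, Compute.checkA_12, Compute.checkA_13, Compute.checkA_14]

/-- Everything certified, for all of `SL(2,ℤ/15ℤ)`. [folklore] -/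
theorem checkAll_eq : Compute.checkAll = true := by
  simp only [Compute.checkAll, List.all_eq_true, List.mem_range]
  exact checkA_all

/-- The kernel certificate at the element `g`. [folklore] -/
theorem checkOne_nt (g : SL2 15) : Compute.checkOne (nt g) = true := by
  have hSL := isSL_nt g
  obtain ⟨⟨a, b, c, e⟩, h⟩ := g
  have hA := checkA_all a.val (ZMod.val_lt a)
  simp only [Compute.checkA, List.all_eq_true, List.mem_range] at hA
  have := hA b.val (ZMod.val_lt b) c.val (ZMod.val_lt c) e.val (ZMod.val_lt e)
  simp only [nt] at hSL
  rw [hSL] at this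
  simpa [nt] using this

section facts

variable (g : SL2 15)

/-- Auxiliary lemma: `: (Compute.repM (Compute.mulM (nt g)) = Compute.repM (nt g) ∧ Compute.sP (Compute.mulP (nt g)) = Compute.sP (nt g) ∧ Compute.kmul Compute.twoX1 (Compute.v (nt g)) = Compute.kscal 2 (Compute.kadd (Compute.sP (nt g)) (C…`. [folklore] -/
private theorem facts :
    (Compute.repM (Compute.mulM (nt g)) = Compute.repM (nt g) ∧
     Compute.sP (Compute.mulP (nt g)) = Compute.sP (nt g) ∧
     Compute.kmul Compute.twoX1 (Compute.v (nt g)) = Compute.kscal 2 (Compute.kadd (Compute.sP (nt g))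
       (Compute.kadd (Compute.sP (Compute.mulM (nt g))) (Compute.sP (Compute.mulM (Compute.mulM (nt g))))))) ∧
    ((Compute.mulP (nt g) ≠ nt g ∧ Compute.mulP (nt g) ≠ Compute.mulM (nt g) ∧
       Compute.mulP (nt g) ≠ Compute.mulM (Compute.mulM (nt g))) ∧
     (Compute.mulP (Compute.mulP (nt g)) ≠ nt g ∧ Compute.mulP (Compute.mulP (nt g)) ≠ Compute.mulM (nt g) ∧
       Compute.mulP (Compute.mulP (nt g)) ≠ Compute.mulM (Compute.mulM (nt g))) ∧
     (Compute.mulP (Compute.mulP (nt g)) ≠ Compute.mulP (nt g) ∧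
       Compute.mulP (Compute.mulP (nt g)) ≠ Compute.mulM (Compute.mulP (nt g)) ∧
       Compute.mulP (Compute.mulP (nt g)) ≠ Compute.mulM (Compute.mulM (Compute.mulP (nt g))))) ∧
    ((Compute.mulM (nt g) ≠ nt g ∧ Compute.mulM (nt g) ≠ Compute.mulP (nt g) ∧
       Compute.mulM (nt g) ≠ Compute.mulP (Compute.mulP (nt g))) ∧
     (Compute.mulM (Compute.mulM (nt g)) ≠ nt g ∧ Compute.mulM (Compute.mulM (nt g)) ≠ Compute.mulP (nt g) ∧
       Compute.mulM (Compute.mulM (nt g)) ≠ Compute.mulP (Compute.mulP (nt g))) ∧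
     (Compute.mulM (Compute.mulM (nt g)) ≠ Compute.mulM (nt g) ∧
       Compute.mulM (Compute.mulM (nt g)) ≠ Compute.mulP (Compute.mulM (nt g)) ∧
       Compute.mulM (Compute.mulM (nt g)) ≠ Compute.mulP (Compute.mulP (Compute.mulM (nt g))))) := by
  have h := checkOne_nt g
  simp only [Compute.checkOne, Compute.notInOrbM, Compute.notInOrbP, Bool.and_eq_true, decide_eq_true_eq,
    Bool.not_eq_true', decide_eq_false_iff_not] at h
  obtain ⟨⟨⟨⟨⟨⟨⟨⟨c₁, c₂⟩, c₃⟩, ⟨⟨n₁, n₁'⟩, n₁''⟩⟩, ⟨⟨n₂, n₂'⟩, n₂''⟩⟩, ⟨⟨n₃, n₃'⟩, n₃''⟩⟩,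
    ⟨⟨n₄, n₄'⟩, n₄''⟩⟩, ⟨⟨n₅, n₅'⟩, n₅''⟩⟩, ⟨⟨n₆, n₆'⟩, n₆''⟩⟩ := h
  exact ⟨⟨c₁, c₂, c₃⟩, ⟨⟨n₁, n₁', n₁''⟩, ⟨n₂, n₂', n₂''⟩, ⟨n₃, n₃', n₃''⟩⟩,
    ⟨⟨n₄, n₄', n₄''⟩, ⟨n₅, n₅', n₅''⟩, ⟨n₆, n₆', n₆''⟩⟩⟩

/-- `v` is a function on the `M₋`-orbits. [folklore] -/
theorem v_mulM : Compute.v (nt (mulM g)) = Compute.v (nt g) := by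
  rw [nt_mulM, Compute.v, Compute.v, (facts g).1.1]

/-- `Bv` is a function on the `M₊`-orbits. [folklore] -/
theorem sP_mulP : Compute.sP (nt (mulP g)) = Compute.sP (nt g) := by
  rw [nt_mulP, (facts g).1.2.1]

/-- The `BᵀB`-eigen-equation `(9 + 4√2 + √5)·v(t) = 2·Σ_{i,j} v(M₊ʲ M₋ⁱ t)` in `ℤ[√2,√5]`. [folklore] -/
theorem eigen_eq :
    Compute.kmul Compute.twoX1 (Compute.v (nt g)) = Compute.kscal 2 (Compute.kadd (Compute.sP (nt g))
      (Compute.kadd (Compute.sP (nt (mulM g))) (Compute.sP (nt (mulM (mulM g)))))) := by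
  simp only [nt_mulM]
  exact (facts g).1.2.2

/-- The three neighbours of the `M₊`-orbit of `g` are distinct … [folklore] -/
theorem vM_ne₁ : vM g ≠ vM (mulP g) := by
  rw [Ne, vM_eq_vM_iff, RelM]
  rintro (h | h | h)
  · exact (facts g).2.1.1.1 (by rw [← nt_mulP, h])
  · exact (facts g).2.1.1.2.1 (by rw [← nt_mulP, ← nt_mulM, h])
  · exact (facts g).2.1.1.2.2 (by rw [← nt_mulP, ← nt_mulM, ← nt_mulM, h])

/-- Auxiliary lemma: `: vM g ≠ vM (mulP (mulP g))`. [folklore] -/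
theorem vM_ne₂ : vM g ≠ vM (mulP (mulP g)) := by
  rw [Ne, vM_eq_vM_iff, RelM]
  rintro (h | h | h)
  · exact (facts g).2.1.2.1.1 (by rw [← nt_mulP, ← nt_mulP, h])
  · exact (facts g).2.1.2.1.2.1 (by rw [← nt_mulP, ← nt_mulP, ← nt_mulM, h])
  · exact (facts g).2.1.2.1.2.2 (by rw [← nt_mulP, ← nt_mulP, ← nt_mulM, ← nt_mulM, h])

/-- Auxiliary lemma: `: vM (mulP g) ≠ vM (mulP (mulP g))`. [folklore] -/
theorem vM_ne₃ : vM (mulP g) ≠ vM (mulP (mulP g)) := by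
  rw [Ne, vM_eq_vM_iff, RelM]
  rintro (h | h | h)
  · exact (facts g).2.1.2.2.1 (by rw [← nt_mulP, ← nt_mulP, h])
  · exact (facts g).2.1.2.2.2.1 (by rw [← nt_mulP, ← nt_mulP, ← nt_mulM, h])
  · exact (facts g).2.1.2.2.2.2 (by rw [← nt_mulP, ← nt_mulP, ← nt_mulM, ← nt_mulM, h])

/-- … and so are the three neighbours of the `M₋`-orbit of `g`. [folklore] -/
theorem vP_ne₁ : vP g ≠ vP (mulM g) := by
  rw [Ne, vP_eq_vP_iff, RelP]
  rintro (h | h | h)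
  · exact (facts g).2.2.1.1 (by rw [← nt_mulM, h])
  · exact (facts g).2.2.1.2.1 (by rw [← nt_mulM, ← nt_mulP, h])
  · exact (facts g).2.2.1.2.2 (by rw [← nt_mulM, ← nt_mulP, ← nt_mulP, h])

/-- Auxiliary lemma: `: vP g ≠ vP (mulM (mulM g))`. [folklore] -/
theorem vP_ne₂ : vP g ≠ vP (mulM (mulM g)) := by
  rw [Ne, vP_eq_vP_iff, RelP]
  rintro (h | h | h)
  · exact (facts g).2.2.2.1.1 (by rw [← nt_mulM, ← nt_mulM, h])
  · exact (facts g).2.2.2.1.2.1 (by rw [← nt_mulM, ← nt_mulM, ← nt_mulP, h])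
  · exact (facts g).2.2.2.1.2.2 (by rw [← nt_mulM, ← nt_mulM, ← nt_mulP, ← nt_mulP, h])

/-- Auxiliary lemma: `: vP (mulM g) ≠ vP (mulM (mulM g))`. [folklore] -/
theorem vP_ne₃ : vP (mulM g) ≠ vP (mulM (mulM g)) := by
  rw [Ne, vP_eq_vP_iff, RelP]
  rintro (h | h | h)
  · exact (facts g).2.2.2.2.1 (by rw [← nt_mulM, ← nt_mulM, h])
  · exact (facts g).2.2.2.2.2.1 (by rw [← nt_mulM, ← nt_mulM, ← nt_mulP, h])
  · exact (facts g).2.2.2.2.2.2 (by rw [← nt_mulM, ← nt_mulM, ← nt_mulP, ← nt_mulP, h])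

end facts

/-- `G₁₅` is `3`-regular (context; (Knauf 2015, arXiv:1305.6410) Prop. 2.12 proves this for every `n ≥ 3`). [folklore] -/
theorem G15_regular : (G 15).IsRegularOfDegree 3 := by
  intro x
  rw [SimpleGraph.degree]
  rcases x with x | x
  · obtain ⟨g, hg⟩ := vP_surjective_left x
    rw [← hg, neighborFinset_vP, Finset.card_insert_of_notMem, Finset.card_pair (vM_ne₃ g)]
    simp [vM_ne₁ g, vM_ne₂ g]
  · obtain ⟨g, hg⟩ := vM_surjective_right x
    rw [← hg, neighborFinset_vM, Finset.card_insert_of_notMem, Finset.card_pair (vP_ne₃ g)]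
    simp [vP_ne₁ g, vP_ne₂ g]

end Literature.MathematicalPhysics.StatisticalMechanics.Knauf1998
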